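import Summits.KontsevichZagierPeriods.KontsevichZagierPeriods.Theorems.FurushoPentagonPentagonInKZCornerAssemblyAux1
import Summits.KontsevichZagierPeriods.KontsevichZagierPeriods.Theorems.FurushoPentagonPentagonInKZSimplexToCube

/-!
# `PentagonInKZ`, line `edge-normal-newton-leibniz`: corner assembly — aux 2 (dilated cubical word integrands)

Second toolkit file for the assembly step (B) of the corner principle (stub
`cornerPrinciple_assembly`, crux `PentagonInKZ`, stmt-KontsevichZagierPeriods-11348): the
DILATED CUBICAL WORD INTEGRANDS `Q_u(x; ξ) = ∏ᵢ [uᵢ = z ? 1/xᵢ : (ξ x₀⋯x_{i-1}) D_{uᵢ}(ξ x₀⋯xᵢ)]`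
of a word `u` over letters with simple-pole densities `D_k(t) = A_k/(B_k + A_k t)` (`A_k, B_k ∈ ℚ`,
pole letter `z` with `D_z = 1/t`, dead letters `A_k = 0`), generic in the side (horizontal /
vertical) of the corner:

* the dilation recursion `Q_succ` and the vanishing order `|Q_u(x; ξ)| ≤ C ξ` on the closed cube
  for words not ending in the pole letter (`Q_bound`), measurability, `ℚ`-semialgebraicity, hence
  goodness of convergent words (`Q_good`);
* the word-by-word transport `word_rel` (registered hook `cornerAssembly_wordRel`): the simplex
  integral `∫ ∏ D_{wᵢ}(tᵢ) dt` over `{bnd > t₀ > ⋯ > 0}` and the cube integral of `Q_w(·; bnd)`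
  differ by Kontsevich–Zagier relations — `simplexToCube` for live words, zero integrands for
  dead ones — and its class form `cls_word`.
-/

noncomputable section

open Set MeasureTheory
open scoped TensorProduct
open Literature.NumberTheory.Transcendental
open Literature.ModelTheory.ExponentialFields (IsSemialgebraic)
open Summit.KontsevichZagierPeriods.FurushoPentagon.PentagonInKZNegative

namespace Summit.KontsevichZagierPeriods.FurushoPentagon.PentagonInKZ

namespace CornerAssembly
/-! ### Dilated cubical word integrands (generic letter densities `D k t = A_k / (B_k + A_k t)`) -/

section Rows

variable {n : ℕ}

/-- `∏_{j < 0} x_j = 1`. [folklore] -/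
theorem prod_filter_lt_zero (x : Fin (n + 1) → ℝ) :
    ∏ j ∈ Finset.univ.filter (fun j : Fin (n + 1) => j < 0), x j = 1 := by
  rw [Finset.filter_false_of_mem (fun j _ => Fin.not_lt_zero j), Finset.prod_empty]

/-- `∏_{j ≤ 0} x_j = x_0`. [folklore] -/
theorem prod_filter_le_zero (x : Fin (n + 1) → ℝ) :
    ∏ j ∈ Finset.univ.filter (fun j : Fin (n + 1) => j ≤ 0), x j = x 0 := by
  have : Finset.univ.filter (fun j : Fin (n + 1) => j ≤ 0) = {0} := by
    ext j
    simp
  rw [this, Finset.prod_singleton]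

/-- `∏_{j < i+1} x_j = x_0 ∏_{j < i} x_{j+1}`. [folklore] -/
theorem prod_filter_lt_succ (x : Fin (n + 1) → ℝ) (i : Fin n) :
    ∏ j ∈ Finset.univ.filter (fun j : Fin (n + 1) => j < i.succ), x j =
      x 0 * ∏ j ∈ Finset.univ.filter (fun j : Fin n => j < i), x j.succ := by
  rw [Finset.prod_filter, Finset.prod_filter, Fin.prod_univ_succ]
  simp [Fin.succ_lt_succ_iff, Fin.succ_pos]

/-- `∏_{j ≤ i+1} x_j = x_0 ∏_{j ≤ i} x_{j+1}`. [folklore] -/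
theorem prod_filter_le_succ (x : Fin (n + 1) → ℝ) (i : Fin n) :
    ∏ j ∈ Finset.univ.filter (fun j : Fin (n + 1) => j ≤ i.succ), x j =
      x 0 * ∏ j ∈ Finset.univ.filter (fun j : Fin n => j ≤ i), x j.succ := by
  rw [Finset.prod_filter, Finset.prod_filter, Fin.prod_univ_succ]
  simp [Fin.succ_le_succ_iff]

/-- `∏_{j ≤ i} x_j = (∏_{j < i} x_j) · x_i`. [folklore] -/
theorem prod_filter_le_eq_mul {m : ℕ} (x : Fin m → ℝ) (i : Fin m) :
    ∏ j ∈ Finset.univ.filter (fun j : Fin m => j ≤ i), x j =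
      (∏ j ∈ Finset.univ.filter (fun j : Fin m => j < i), x j) * x i := by
  rw [← SimplexToCube.filter_le_erase i, Finset.prod_erase_mul _ _ (by simp)]

/-- The last letter of a nonempty word `List.ofFn u`. [folklore] -/
theorem getLast?_ofFn_succ {α : Type*} {k : ℕ} (u : Fin (k + 1) → α) :
    (List.ofFn u).getLast? = some (u (Fin.last k)) := by
  rw [List.ofFn_succ', List.concat_eq_append, List.getLast?_append, List.getLast?_singleton,
    Option.some_or]

end Rows

section Words

variable {L : Type} [DecidableEq L] (z : L) (A B : L → ℚ) (D : L → ℝ → ℝ)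
  (hD : ∀ k t, D k t = (A k : ℝ) / ((B k : ℝ) + (A k : ℝ) * t)) (hAz : A z = 1) (hBz : B z = 0)
  (Q : ∀ {n : ℕ}, (Fin n → L) → (Fin n → ℝ) → ℝ → ℝ)
  (hQ : ∀ {n : ℕ} (u : Fin n → L) (x : Fin n → ℝ) (ξ : ℝ),
    Q u x ξ = ∏ i, if u i = z then 1 / x i else
      (ξ * ∏ j ∈ Finset.univ.filter (fun j => j < i), x j) *
        D (u i) (ξ * ∏ j ∈ Finset.univ.filter (fun j => j ≤ i), x j))

include hQ in
/-- **Dilation recursion**: peeling the outermost letter, `Q_u(x; ξ) = T₀(x₀; ξ) · Q_{tail u}(tail x; ξ x₀)`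
with `T₀ = 1/x₀` for the pole letter and `ξ D_{u₀}(ξ x₀)` otherwise. [folklore] -/
theorem Q_succ {n : ℕ} (u : Fin (n + 1) → L) (x : Fin (n + 1) → ℝ) (ξ : ℝ) :
    Q u x ξ = (if u 0 = z then 1 / x 0 else ξ * D (u 0) (ξ * x 0)) *
      Q (Fin.tail u) (Fin.tail x) (ξ * x 0) := by
  rw [hQ, hQ, Fin.prod_univ_succ]
  congr 1
  · rw [prod_filter_lt_zero, prod_filter_le_zero, mul_one]
  · refine Finset.prod_congr rfl fun i _ => ?_
    simp only [Fin.tail, prod_filter_lt_succ, prod_filter_le_succ, mul_assoc]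

include hQ in
/-- **Vanishing order at `ξ = 0`**: a word whose innermost letter is not the pole letter has a
dilated integrand bounded by `C ξ` on the closed cube, uniformly in `ξ ∈ [0, bnd]` (induction on the
length through the dilation recursion; the pole factors `1/x₀` are absorbed by the `ξ x₀` of the
tail). [folklore] -/
theorem Q_bound (M bnd : ℝ) (hM0 : 0 ≤ M) (hbnd : 0 ≤ bnd)
    (hM : ∀ k, k ≠ z → ∀ t, 0 ≤ t → t ≤ bnd → |D k t| ≤ M) :
    ∀ (k : ℕ) (u : Fin (k + 1) → L), u (Fin.last k) ≠ z →
      ∃ C, 0 ≤ C ∧ ∀ ξ, 0 ≤ ξ → ξ ≤ bnd → ∀ x ∈ KZ.cube (k + 1), |Q u x ξ| ≤ C * ξ := by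
  intro k
  induction k with
  | zero =>
    intro u hu
    rw [Fin.last_zero] at hu
    refine ⟨M, hM0, fun ξ hξ0 hξb x hx => ?_⟩
    have hx0 := (KZ.mem_cube.1 hx) 0
    have h1 : Q u x ξ = ξ * D (u 0) (ξ * x 0) := by
      rw [Q_succ z D Q hQ, if_neg hu, hQ]
      simp
    rw [h1, abs_mul, abs_of_nonneg hξ0, mul_comm]
    exact mul_le_mul_of_nonneg_right
      (hM _ hu _ (mul_nonneg hξ0 hx0.1) ((mul_le_of_le_one_right hξ0 hx0.2).trans hξb)) hξ0
  | succ k ih =>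
    intro u hu
    obtain ⟨C', hC'0, hC'⟩ := ih (Fin.tail u) (by simpa only [Fin.tail, Fin.succ_last] using hu)
    refine ⟨C' + bnd * M * C', by positivity, fun ξ hξ0 hξb x hx => ?_⟩
    have hx0 := (KZ.mem_cube.1 hx) 0
    have htail : Fin.tail x ∈ KZ.cube (k + 1) := fun i => (KZ.mem_cube.1 hx) i.succ
    have hξx : 0 ≤ ξ * x 0 ∧ ξ * x 0 ≤ bnd :=
      ⟨mul_nonneg hξ0 hx0.1, (mul_le_of_le_one_right hξ0 hx0.2).trans hξb⟩
    have hrec := hC' (ξ * x 0) hξx.1 hξx.2 (Fin.tail x) htail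
    have hCξ : 0 ≤ C' * ξ := mul_nonneg hC'0 hξ0
    have hle : C' * ξ ≤ (C' + bnd * M * C') * ξ :=
      mul_le_mul_of_nonneg_right (le_add_of_nonneg_right (by positivity)) hξ0
    rw [Q_succ z D Q hQ, abs_mul]
    by_cases h0 : u 0 = z
    · rw [if_pos h0]
      rcases hx0.1.eq_or_lt with h00 | h00
      · rw [← h00, div_zero, abs_zero, zero_mul]
        exact hCξ.trans hle
      · calc |1 / x 0| * |Q (Fin.tail u) (Fin.tail x) (ξ * x 0)|
            ≤ (1 / x 0) * (C' * (ξ * x 0)) := by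
              rw [abs_of_pos (one_div_pos.2 h00)]
              exact mul_le_mul_of_nonneg_left hrec (one_div_pos.2 h00).le
          _ = C' * ξ := by field_simp
          _ ≤ (C' + bnd * M * C') * ξ := hle
    · rw [if_neg h0]
      calc |ξ * D (u 0) (ξ * x 0)| * |Q (Fin.tail u) (Fin.tail x) (ξ * x 0)|
          ≤ (ξ * M) * (C' * (ξ * x 0)) := by
            rw [abs_mul, abs_of_nonneg hξ0]
            exact mul_le_mul (mul_le_mul_of_nonneg_left (hM _ h0 _ hξx.1 hξx.2) hξ0) hrec
              (abs_nonneg _) (by positivity)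
        _ ≤ (ξ * M) * (C' * bnd) :=
            mul_le_mul_of_nonneg_left (mul_le_mul_of_nonneg_left hξx.2 hC'0) (by positivity)
        _ = (bnd * M * C') * ξ := by ring
        _ ≤ (C' + bnd * M * C') * ξ :=
            mul_le_mul_of_nonneg_right (le_add_of_nonneg_left hC'0) hξ0

include hD hQ in
/-- The dilated word integrands are measurable. [folklore] -/
theorem Q_measurable {k : ℕ} (u : Fin k → L) (ξ : ℝ) : Measurable (fun x => Q u x ξ) := by
  have hDm : ∀ a, Measurable (D a) := fun a => by
    have : D a = fun t => (A a : ℝ) / ((B a : ℝ) + (A a : ℝ) * t) := funext (hD a)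
    rw [this]
    exact measurable_const.div (measurable_const.add (measurable_const.mul measurable_id))
  have h : (fun x => Q u x ξ) = fun x => ∏ i, (if u i = z then 1 / x i else
      (ξ * ∏ j ∈ Finset.univ.filter (fun j => j < i), x j) *
        D (u i) (ξ * ∏ j ∈ Finset.univ.filter (fun j => j ≤ i), x j)) :=
    funext fun x => hQ u x ξ
  rw [h]
  refine Finset.measurable_prod _ fun i _ => ?_
  by_cases hi : u i = z
  · simp only [hi, if_true]
    exact (measurable_pi_apply i).const_div 1
  · simp only [hi, if_false]
    exact (measurable_const.mul (Finset.measurable_prod _ fun j _ => measurable_pi_apply j)).mul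
      ((hDm (u i)).comp
        (measurable_const.mul (Finset.measurable_prod _ fun j _ => measurable_pi_apply j)))

include hD hQ in
/-- The dilated word integrands are `ℚ`-semialgebraic on the closed cube (rational functions with
rational coefficients; Lean's total `x⁻¹` included). [cite: BochnakCosteRoy1998, Prop. 2.2.6] -/
theorem Q_semialg {k : ℕ} (u : Fin k → L) (ξ : ℚ) :
    IsSemialgebraicFunOn ℚ (KZ.cube k) (fun x => Q u x ξ) := by
  have hc := KZ.isSemialgebraic_cube (n := k)
  have hcoord : ∀ j : Fin k, IsSemialgebraicFunOn ℚ (KZ.cube k) (fun x => x j) := fun j =>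
    (isSemialgebraicFunOn_aeval hc (MvPolynomial.X j)).congr fun x _ => by simp
  have hP : ∀ (p : Fin k → Prop) [DecidablePred p],
      IsSemialgebraicFunOn ℚ (KZ.cube k) (fun x => (ξ : ℝ) * ∏ j ∈ Finset.univ.filter p, x j) :=
    fun p _ => (isSemialgebraicFunOn_const_ratCast hc ξ).fun_mul
      (IsSemialgebraicFunOn.fun_finsetProd _ hc fun j _ => hcoord j)
  refine (IsSemialgebraicFunOn.fun_finsetProd Finset.univ hc
    (F := fun i x => if u i = z then 1 / x i else
      ((ξ : ℝ) * ∏ j ∈ Finset.univ.filter (fun j => j < i), x j) *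
        D (u i) ((ξ : ℝ) * ∏ j ∈ Finset.univ.filter (fun j => j ≤ i), x j)) fun i _ => ?_).congr
    fun x _ => (hQ u x ξ).symm
  by_cases h : u i = z
  · simp only [h, if_true]
    exact (hcoord i).fun_inv.congr fun x _ => (one_div (x i)).symm
  · simp only [h, if_false]
    have hDc : IsSemialgebraicFunOn ℚ (KZ.cube k)
        (fun x => D (u i) ((ξ : ℝ) * ∏ j ∈ Finset.univ.filter (fun j => j ≤ i), x j)) := by
      refine ((isSemialgebraicFunOn_const_ratCast hc (A (u i))).fun_mul
        (((isSemialgebraicFunOn_const_ratCast hc (B (u i))).fun_add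
          ((isSemialgebraicFunOn_const_ratCast hc (A (u i))).fun_mul (hP (· ≤ i)))).fun_inv)).congr
        fun x _ => ?_
      simp only
      rw [hD, div_eq_mul_inv]
    exact (hP (· < i)).fun_mul hDc

include hD hQ in
/-- **Goodness of convergent words**: for a word `u` not ending in the pole letter `z` and a
rational dilation `0 ≤ bnd` at which all other densities are bounded on `[0, bnd]`, the dilated
integrand `x ↦ Q_u(x; bnd)` is a good integrand on the closed cube. [folklore] -/
theorem Q_good (M : ℝ) (bnd : ℚ) (hM0 : 0 ≤ M) (hbnd : 0 ≤ (bnd : ℝ))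
    (hM : ∀ k, k ≠ z → ∀ t : ℝ, 0 ≤ t → t ≤ (bnd : ℝ) → |D k t| ≤ M) {k : ℕ} (u : Fin k → L)
    (hu : (List.ofFn u).getLast? ≠ some z) : (IsSemialgebraicFunOn ℚ (KZ.cube k) (fun x => Q u x bnd) ∧ IntegrableOn (fun x => Q u x bnd) (KZ.cube k)) := by
  refine ⟨Q_semialg z A B D hD Q hQ u bnd, ?_⟩
  cases k with
  | zero =>
    have : (fun x : Fin 0 → ℝ => Q u x bnd) = fun _ => 1 := funext fun x => by rw [hQ]; simp
    rw [this]
    exact integrableOn_const (by simp)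
  | succ k =>
    have hu' : u (Fin.last k) ≠ z := fun h => hu (by rw [getLast?_ofFn_succ, h])
    obtain ⟨C, -, hC⟩ := Q_bound z D Q hQ M bnd hM0 hbnd hM k u hu'
    refine Measure.integrableOn_of_bounded (M := C * bnd) (by simp)
      (Q_measurable z A B D hD Q hQ u bnd).aestronglyMeasurable ?_
    exact (ae_restrict_iff' KZ.measurableSet_cube).2 (ae_of_all _ fun x hx => by
      rw [Real.norm_eq_abs]; exact hC bnd hbnd le_rfl x hx)

include hD hAz hQ in
/-- **Dead words**: a word containing a letter of density `0` (`A_k = 0`) has integrand `0`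
everywhere. [folklore] -/
theorem Q_dead {n : ℕ} (u : Fin n → L) {i : Fin n} (hi : A (u i) = 0) (x : Fin n → ℝ) (ξ : ℝ) :
    Q u x ξ = 0 := by
  rw [hQ]
  apply Finset.prod_eq_zero (Finset.mem_univ i)
  have hne : u i ≠ z := fun h => by
    rw [h, hAz] at hi
    exact one_ne_zero hi
  rw [if_neg hne, hD, hi, Rat.cast_zero, zero_div, mul_zero]

omit [DecidableEq L] in
include hD in
/-- **Live letters are simple poles**: `D_k(t) = 1/(t − π_k)` with `π_k = −B_k/A_k` when `A_k ≠ 0`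
(valid with Lean's `x/0 = 0`). [folklore] -/
theorem D_live {k : L} (hk : A k ≠ 0) (t : ℝ) :
    D k t = 1 / (t - ((-(B k) / A k : ℚ) : ℝ)) := by
  have hA : (A k : ℝ) ≠ 0 := by exact_mod_cast hk
  rw [hD, Rat.cast_div, Rat.cast_neg, sub_eq_add_neg, neg_div, neg_neg,
    show (B k : ℝ) + (A k : ℝ) * t = (A k : ℝ) * (t + (B k : ℝ) / (A k : ℝ)) by
      field_simp; ring,
    div_mul_eq_div_div, div_self hA]

include hD hAz hBz hQ in
/-- **On the open cube a live word is the pulled-back simplex form**: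
`Q_u(x; bnd) = ∏ᵢ (bnd ∏_{j<i} x_j)/(bnd ∏_{j≤i} x_j − πᵢ)`, `πᵢ = −B/A` of the `i`-th letter
(the shape of `simplexToCube`). [cite: Souderes2010, §1.3] -/
theorem Q_open (bnd : ℚ) (hbnd : 0 < bnd) {n : ℕ} (u : Fin n → L) (hlive : ∀ i, A (u i) ≠ 0)
    (x : Fin n → ℝ) (hx : ∀ i, 0 < x i ∧ x i < 1) :
    Q u x bnd = ∏ i : Fin n, ((bnd : ℝ) * ∏ j ∈ Finset.univ.filter (fun j : Fin n => j < i), x j) /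
      ((bnd : ℝ) * (∏ j ∈ Finset.univ.filter (fun j : Fin n => j ≤ i), x j) -
        ((-(B (u i)) / A (u i) : ℚ) : ℝ)) := by
  rw [hQ]
  refine Finset.prod_congr rfl fun i _ => ?_
  have hP : 0 < (bnd : ℝ) * ∏ j ∈ Finset.univ.filter (fun j : Fin n => j < i), x j :=
    mul_pos (by exact_mod_cast hbnd) (Finset.prod_pos fun j _ => (hx j).1)
  by_cases h : u i = z
  · rw [if_pos h, h, hAz, hBz, prod_filter_le_eq_mul, ← mul_assoc]
    push_cast
    rw [neg_zero, zero_div, sub_zero, div_mul_cancel_left₀ hP.ne', one_div]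
  · rw [if_neg h, D_live A B D hD (hlive i), mul_one_div]

include hD hAz hBz hQ in
/-- **The word-by-word transport** (cube ↔ simplex): for a word `w`, a representation `I` over
the scaled open simplex `{bnd > t₀ > ⋯ > 0}` with integrand `∏ D_{wᵢ}(tᵢ)` and a representation
`r'` over the closed cube with integrand `Q_w(·; bnd)` differ by Kontsevich–Zagier relations:
`simplexToCube` when every letter is live, and both are relations (zero integrands) when some
letter is dead. [cite: KontsevichZagier2001, §1.2 rules (1), (2)] -/
theorem word_rel (bnd : ℚ) (hbnd : 0 < bnd) (w : List L) (I : KZ.IntegralRep w.length)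
    (hI : I.domain = {t | (∀ i, 0 < t i ∧ t i < (bnd : ℝ)) ∧ StrictAnti t} ∧
      EqOn I.integrand (fun t => ∏ i, D (w.get i) (t i)) I.domain)
    (r' : KZ.IntegralRep w.length) (hr' : r'.domain = KZ.cube w.length)
    (hr'i : ∀ x ∈ KZ.cube w.length, r'.integrand x = Q w.get x bnd) :
    KZ.of I - KZ.of r' ∈ KZ.relations := by
  by_cases hlive : ∀ i, A (w.get i) ≠ 0
  · refine simplexToCube w.length bnd (fun i => -(B (w.get i)) / A (w.get i)) I r' hbnd hI.1
      (fun t ht => ?_) hr' (fun x hx => ?_)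
    · rw [hI.2 ht]
      exact Finset.prod_congr rfl fun i _ => D_live A B D hD (hlive i) (t i)
    · rw [hr'i x (KZ.openUnitCube_subset_cube hx)]
      exact Q_open z A B D hD hAz hBz Q hQ bnd hbnd w.get hlive x hx
  · push Not at hlive
    obtain ⟨i, hi⟩ := hlive
    refine KZ.relations.sub_mem (KZ.of_mem_relations_of_eqOn_zero I fun t ht => ?_)
      (KZ.of_mem_relations_of_eqOn_zero r' fun x hx => ?_)
    · rw [Pi.zero_apply, hI.2 ht]
      exact Finset.prod_eq_zero (Finset.mem_univ i) (by rw [hD, hi, Rat.cast_zero, zero_div])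
    · rw [hr'] at hx
      rw [Pi.zero_apply, hr'i x hx]
      exact Q_dead z A B D hD hAz Q hQ w.get hi x bnd

omit [DecidableEq L] in
/-- Relabelling a word along `Fin n' = Fin n` relabels the cube coordinates. [folklore] -/
theorem Q_comp_cast {n n' : ℕ} (h : n' = n) (u : Fin n → L) (x : Fin n' → ℝ) (ξ : ℝ) :
    Q (u ∘ Fin.cast h) x ξ = Q u (fun i => x (Fin.cast h.symm i)) ξ := by
  subst h
  rfl

include hD hAz hBz hQ in
/-- **The class of a convergent word is the class of its simplex integral**: for `u : Fin k → L`
with a good dilated integrand `x ↦ Q_u(x; bnd)` (e.g. `u` not ending in the pole letter),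
`⟦cube_k, Q_u(·; bnd)⟧ = χ₀ [I (ofFn u)]` in `P_ℚ` (`word_rel` after reindexing
`Fin k ≃ Fin |ofFn u|`). [cite: KontsevichZagier2001, §1.2] -/
theorem cls_word (bnd : ℚ) (hbnd : 0 < bnd) (I : (w : List L) → KZ.IntegralRep w.length)
    (hI : ∀ w : List L, w.getLast? ≠ some z →
      (I w).domain = {t | (∀ i, 0 < t i ∧ t i < (bnd : ℝ)) ∧ StrictAnti t} ∧
      EqOn (I w).integrand (fun t => ∏ i, D (w.get i) (t i)) (I w).domain)
    {k : ℕ} (u : Fin k → L) (hu : (List.ofFn u).getLast? ≠ some z)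
    (hg : (IsSemialgebraicFunOn ℚ (KZ.cube k) (fun x => Q u x bnd) ∧ IntegrableOn (fun x => Q u x bnd) (KZ.cube k))) :
    chiUniv (KZ.of (KZ.IntegralRep.mk (KZ.cube k) (fun x => Q u x bnd) KZ.isSemialgebraic_cube (And.left hg) (And.right hg))) = chiUniv (KZ.of (I (List.ofFn u))) := by
  have hlen : (List.ofFn u).length = k := List.length_ofFn
  let e : Fin k ≃ Fin (List.ofFn u).length := finCongr hlen.symm
  have h1 := KZ.of_sub_of_reindex_mem_relations (KZ.IntegralRep.mk (KZ.cube k) (fun x => Q u x bnd) KZ.isSemialgebraic_cube (And.left hg) (And.right hg)) e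
  have hget : (List.ofFn u).get = u ∘ Fin.cast hlen := funext fun i => by
    rw [List.get_ofFn]
    rfl
  have h2 := word_rel z A B D hD hAz hBz Q hQ bnd hbnd (List.ofFn u) (I (List.ofFn u)) (hI _ hu)
    ((KZ.IntegralRep.mk (KZ.cube k) (fun x => Q u x bnd) KZ.isSemialgebraic_cube (And.left hg) (And.right hg)).reindex e) (by
      ext w
      simp only [KZ.IntegralRep.reindex_domain, mem_setOf_eq, KZ.mem_cube]
      exact ⟨fun h j => by simpa [e] using h (e.symm j), fun h i => h (e i)⟩)
    (fun x _ => by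
      rw [hget, Q_comp_cast Q hlen]
      rfl)
  refine chiUniv_eq_of_sub_mem ?_
  have : KZ.of (KZ.IntegralRep.mk (KZ.cube k) (fun x => Q u x bnd) KZ.isSemialgebraic_cube (And.left hg) (And.right hg)) - KZ.of (I (List.ofFn u)) =
      (KZ.of (KZ.IntegralRep.mk (KZ.cube k) (fun x => Q u x bnd) KZ.isSemialgebraic_cube (And.left hg) (And.right hg)) - KZ.of ((KZ.IntegralRep.mk (KZ.cube k) (fun x => Q u x bnd) KZ.isSemialgebraic_cube (And.left hg) (And.right hg)).reindex e)) -
        (KZ.of (I (List.ofFn u)) - KZ.of ((KZ.IntegralRep.mk (KZ.cube k) (fun x => Q u x bnd) KZ.isSemialgebraic_cube (And.left hg) (And.right hg)).reindex e)) := by abel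
  rw [this]
  exact KZ.relations.sub_mem h1 h2

include hD in
/-- **Uniform bound for the regular letters**: if every letter `k ≠ z` is either dead (`A_k = 0`)
or has a non-vanishing denominator on `[0, bnd]`, then `|D_k| ≤ M` there for one `M ≥ 0`
(continuity on a compact interval, finitely many letters). [folklore] -/
theorem exists_bound [Fintype L] (bnd : ℝ)
    (hden : ∀ k, k ≠ z → A k = 0 ∨ ∀ t, 0 ≤ t → t ≤ bnd → (B k : ℝ) + (A k : ℝ) * t ≠ 0) :
    ∃ M, 0 ≤ M ∧ ∀ k, k ≠ z → ∀ t, 0 ≤ t → t ≤ bnd → |D k t| ≤ M := by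
  have hk : ∀ k, ∃ Mk, 0 ≤ Mk ∧ (k ≠ z → ∀ t, 0 ≤ t → t ≤ bnd → |D k t| ≤ Mk) := by
    intro k
    by_cases hkz : k = z
    · exact ⟨0, le_rfl, fun h => absurd hkz h⟩
    rcases hden k hkz with hA | hB
    · refine ⟨0, le_rfl, fun _ t _ _ => ?_⟩
      rw [hD, hA, Rat.cast_zero, zero_div, abs_zero]
    · have hcont : ContinuousOn (fun t => (A k : ℝ) / ((B k : ℝ) + (A k : ℝ) * t)) (Icc 0 bnd) :=
        continuousOn_const.div (by fun_prop) fun t ht => hB t ht.1 ht.2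
      obtain ⟨Mk, hMk⟩ := isCompact_Icc.exists_bound_of_continuousOn hcont
      refine ⟨max Mk 0, le_max_right _ _, fun _ t ht0 ht1 => ?_⟩
      rw [hD]
      exact ((Real.norm_eq_abs _).symm.le.trans (hMk t ⟨ht0, ht1⟩)).trans (le_max_left _ _)
  choose Mk hMk0 hMk using hk
  refine ⟨∑ k, Mk k, Finset.sum_nonneg fun k _ => hMk0 k, fun k hkz t ht0 ht1 => ?_⟩
  exact (hMk k hkz t ht0 ht1).trans
    (Finset.single_le_sum (fun k _ => hMk0 k) (Finset.mem_univ k))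

end Words

end CornerAssembly

open CornerAssembly in
/-- **Hook `cornerAssembly_wordRel`** (registered spelling of `CornerAssembly.word_rel`): cube and
simplex representations of a word differ by Kontsevich–Zagier relations.
[cite: KontsevichZagier2001, §1.2 rules (1), (2)] -/
theorem cornerAssembly_wordRel : ∀ (L : Type) [DecidableEq L] (z : L) (A B : L → ℚ) (D : L → ℝ → ℝ), (∀ k t, D k t = (A k : ℝ) / ((B k : ℝ) + (A k : ℝ) * t)) → A z = 1 → B z = 0 → ∀ (Q : ∀ {n : ℕ}, (Fin n → L) → (Fin n → ℝ) → ℝ → ℝ), (∀ {n : ℕ} (u : Fin n → L) (x : Fin n → ℝ) (ξ : ℝ), Q u x ξ = ∏ i, if u i = z then 1 / x i else (ξ * ∏ j ∈ Finset.univ.filter (fun j => j < i), x j) * D (u i) (ξ * ∏ j ∈ Finset.univ.filter (fun j => j ≤ i), x j)) → ∀ (bnd : ℚ), 0 < bnd → ∀ (w : List L) (I : KZ.IntegralRep w.length), (I.domain = {t | (∀ i, 0 < t i ∧ t i < (bnd : ℝ)) ∧ StrictAnti t} ∧ Set.EqOn I.integrand (fun t => ∏ i, D (w.get i) (t i)) I.domain)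 → ∀ (r' : KZ.IntegralRep w.length), r'.domain = KZ.cube w.length → (∀ x ∈ KZ.cube w.length, r'.integrand x = Q w.get x bnd) → KZ.of I - KZ.of r' ∈ KZ.relations :=
  fun _ _ z A B D hD hAz hBz Q hQ bnd hbnd w I hI r' hr' hr'i =>
    word_rel z A B D hD hAz hBz Q hQ bnd hbnd w I hI r' hr' hr'i

end Summit.KontsevichZagierPeriods.FurushoPentagon.PentagonInKZ
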